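import Mathlib
import Summits.Ventures.Crystal3D.Theses.StickyWulffConstant
import Summits.Ventures.Crystal3D.Theorems.StickyWulffConstantTextureLiminfTexShadowDefs
import Summits.Ventures.Crystal3D.LocalLP.ContactBridge
import Summits.Ventures.Crystal3D.StickySpheres.FinsetBridge
import Literature.Analysis.Convexity.AnisotropicPerimeterTransform
import Literature.Analysis.Convexity.FinitePerimeterTransform
import Summits.Ventures.Crystal3D.Theorems.StickyWulffConstantTextureLiminfTexShadowVocabulary
import HarnessLib

/-!
# Line `TexShadow` (stmt-Ventures-19483, v6.2): the stub `stub_unsaturate` — part 1, the SATURATION LEMMA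

HONEST FRAMING. Part of the venture `Summits/Ventures/Crystal3D` (cell `crystal3d-full`), route
`route-Ventures-StickyWulffConstant`, crux `TextureLiminf` (stmt-Ventures-19483), `--supports` helper (file 1 of 2
of the literature seat's kernel-checked kit HOME/cf-lit/unsat/, lit gen 10; landed by the prover seat eng gen 9 at the
planner's request, cf-p1 INBOX 2026-08-27T18:45:48Z; split in two only to respect the 400-line rule).

* §2 `exists_saturated_finset` — the Finset saturation lemma: every finite `1`-separated `X ⊂ ℝ³` admits a
  6|6-saturated `1`-separated `X'` (every point `≥ 6` contacts, every admissible site `≤ 6` touches) with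
  `D(X') + #(X' ∖ X) + #(X ∖ X') ≤ D(X)` (alternating delete-a-ball-with-≤5-contacts / add-a-ball-at-an-
  admissible-site-with-≥7-contacts; each step lowers `D = 6#X − C` by `≥ 1`; termination by `D ≥ 0`, i.e. the
  kissing bound `k(3) = 12` = `musin2006_kissing_three_holds`);
* §3 `exists_saturated` — the labelled form, EXACTLY the signature of the planner's support sketch
  `HOME/cf-p1/route/lines/tex/Saturation.lean` (via `StickySpheres/FinsetBridge`).
Part 2 (`…Unsaturate.lean`): dilation of textures and `stub_unsaturate : ShadowTheoremSat → ShadowTheorem`.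
WHAT THIS IS NOT: any progress on `stub_textureBuild`, `stub_bilayerWall`, `stub_barlowAdhesionR`,
`stub_resolution`, `stub_barlowFreeCertificate`; rung F-C1 not moved.
-/

open scoped BigOperators InnerProductSpace ENNReal Pointwise
open MeasureTheory Filter Finset

namespace Summit.Ventures.Crystal3D.Cruxes.TextureLiminf.TexShadow

open Summit.Ventures.Crystal3D
open Literature.MathematicalPhysics.StatisticalMechanics (fccStacking barlowStacking IsHaggSeq
  fieldDivergence HasFinitePerimeter perimeter contactDeficiency orderedContacts)
open Literature.Analysis.Convexity (anisotropicPerimeter anisotropicPerimeter_smul perimeter_smul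
  perimeter_eq_anisotropicPerimeter_closedBall)

/-! ## §2 The Finset saturation lemma -/

section FinsetSaturation

/-- number of points of `X` at distance exactly `1` from `y` -/
private noncomputable def deg (X : Finset E3) (y : E3) : ℕ := (X.filter fun q => dist y q = 1).card

/-- Unfolding lemma for `deg`. -/
private theorem deg_eq (X : Finset E3) (y : E3) : deg X y = (X.filter fun q => dist y q = 1).card := rfl

/-- `orderedContacts X = Σ_{x∈X} deg X x` -/
private theorem orderedContacts_eq_sum_deg (X : Finset E3) :
    orderedContacts X = ∑ x ∈ X, deg X x := by
  rw [orderedContacts, Finset.card_filter, Finset.sum_product]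
  refine Finset.sum_congr rfl fun x _ => ?_
  rw [deg, Finset.card_filter]

/-- erasing a point removes its contacts twice from the ordered count -/
private theorem orderedContacts_erase_add (X : Finset E3) {p : E3} (hp : p ∈ X) :
    orderedContacts (X.erase p) + 2 * deg X p = orderedContacts X := by
  classical
  rw [orderedContacts_eq_sum_deg, orderedContacts_eq_sum_deg, ← Finset.add_sum_erase X _ hp]
  -- for `x ≠ p`: `deg X x = deg (X.erase p) x + [dist x p = 1]`
  have hsplit : ∀ x ∈ X.erase p, deg X x = deg (X.erase p) x + (if dist x p = 1 then 1 else 0) := by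
    intro x hx
    have hpX : p ∉ (X.erase p).filter (fun q => dist x q = 1) := fun h =>
      Finset.notMem_erase p X (Finset.mem_filter.1 h).1
    rw [deg, deg]
    conv_lhs => rw [← Finset.insert_erase hp]
    rw [Finset.filter_insert]
    split_ifs with h
    · rw [Finset.card_insert_of_notMem hpX]
    · rw [add_zero]
  rw [Finset.sum_congr rfl hsplit, Finset.sum_add_distrib]
  -- the indicator sum is `deg X p` again (symmetry of `dist`; `p` itself is not at distance 1)
  have hind : (∑ x ∈ X.erase p, (if dist x p = 1 then 1 else 0 : ℕ)) = deg X p := by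
    rw [Finset.sum_boole, Nat.cast_id, deg]
    congr 1
    ext q
    simp only [Finset.mem_filter, Finset.mem_erase]
    constructor
    · rintro ⟨⟨-, hq⟩, h⟩; exact ⟨hq, by rwa [dist_comm]⟩
    · rintro ⟨hq, h⟩
      refine ⟨⟨?_, hq⟩, by rwa [dist_comm]⟩
      rintro rfl
      simp at h
  rw [hind]
  ring

/-- `D(X ∖ p) = D(X) − 6 + deg X p` -/
private theorem contactDeficiency_erase (X : Finset E3) {p : E3} (hp : p ∈ X) :
    contactDeficiency (X.erase p) = contactDeficiency X - 6 + deg X p := by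
  have h := orderedContacts_erase_add X hp
  rw [contactDeficiency, contactDeficiency, Finset.card_erase_of_mem hp,
    Nat.cast_sub (Finset.card_pos.2 ⟨p, hp⟩)]
  have h' : (orderedContacts X : ℝ) = orderedContacts (X.erase p) + 2 * deg X p := by
    exact_mod_cast h.symm
  rw [h']
  push_cast
  ring

/-- `deg (insert y X) y = deg X y` (`y` is not at distance `1` from itself) -/
private theorem deg_insert_self (X : Finset E3) (y : E3) : deg (insert y X) y = deg X y := by
  classical
  rw [deg, deg, Finset.filter_insert]
  simp

/-- `D(X ∪ {y}) = D(X) + 6 − deg X y` for `y ∉ X` -/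
private theorem contactDeficiency_insert (X : Finset E3) {y : E3} (hy : y ∉ X) :
    contactDeficiency (insert y X) = contactDeficiency X + 6 - deg X y := by
  classical
  have h := contactDeficiency_erase (insert y X) (Finset.mem_insert_self y X)
  rw [Finset.erase_insert hy, deg_insert_self] at h
  linarith

/-- kissing bound: at most twelve points of a `1`-separated set are at distance exactly `1` from any point -/
private theorem deg_le_twelve (X : Finset E3) (hX : ∀ p ∈ X, ∀ q ∈ X, p ≠ q → 1 ≤ dist p q) (y : E3) :
    deg X y ≤ 12 := by
  classical
  rw [deg]
  set S := X.filter fun q => dist y q = 1 with hS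
  have hinj : Set.InjOn (fun q : E3 => q - y) ↑S := fun a _ b _ h => sub_left_injective h
  rw [← Finset.card_image_of_injOn hinj]
  refine Literature.Geometry.DiscreteGeometry.musin2006_kissing_three_holds _ ?_ ?_
  · intro v hv
    obtain ⟨q, hq, rfl⟩ := Finset.mem_image.1 hv
    have hq1 : dist y q = 1 := (Finset.mem_filter.1 hq).2
    rw [← dist_eq_norm, dist_comm, hq1]
  · intro v hv w hw hvw
    obtain ⟨q, hq, rfl⟩ := Finset.mem_image.1 hv
    obtain ⟨q', hq', rfl⟩ := Finset.mem_image.1 hw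
    have hne : q ≠ q' := fun h => hvw (by rw [h])
    rw [dist_sub_right]
    exact hX q (Finset.mem_filter.1 hq).1 q' (Finset.mem_filter.1 hq').1 hne

/-- `D(X) ≥ 0` for a `1`-separated finite set (kissing bound) -/
private theorem contactDeficiency_nonneg' (X : Finset E3)
    (hX : ∀ p ∈ X, ∀ q ∈ X, p ≠ q → 1 ≤ dist p q) : 0 ≤ contactDeficiency X := by
  rw [contactDeficiency, orderedContacts_eq_sum_deg]
  have h : (∑ x ∈ X, deg X x : ℕ) ≤ 12 * X.card := by
    calc ∑ x ∈ X, deg X x ≤ ∑ x ∈ X, 12 := Finset.sum_le_sum fun x _ => deg_le_twelve X hX x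
      _ = 12 * X.card := by rw [Finset.sum_const, smul_eq_mul, mul_comm]
  have h' : ((∑ x ∈ X, deg X x : ℕ) : ℝ) ≤ 12 * X.card := by exact_mod_cast h
  linarith

/-- one improvement step: a non-saturated `1`-separated set has a `1`-separated modification by one point with
deficiency lower by `≥ 1` -/
private theorem saturation_step (X : Finset E3) (hX : ∀ p ∈ X, ∀ q ∈ X, p ≠ q → 1 ≤ dist p q)
    (hns : ¬ ((∀ p ∈ X, 6 ≤ deg X p) ∧ ∀ y : E3, (∀ p ∈ X, 1 ≤ dist y p) → deg X y ≤ 6)) :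
    ∃ X₁ : Finset E3, (∀ p ∈ X₁, ∀ q ∈ X₁, p ≠ q → 1 ≤ dist p q) ∧
      contactDeficiency X₁ ≤ contactDeficiency X - 1 ∧
      (X₁ \ X).card + (X \ X₁).card ≤ 1 := by
  classical
  by_cases h6 : ∀ p ∈ X, 6 ≤ deg X p
  · -- some admissible site touches `≥ 7` points: add it
    have hns' : ¬ ∀ y : E3, (∀ p ∈ X, 1 ≤ dist y p) → deg X y ≤ 6 := fun h => hns ⟨h6, h⟩
    push Not at hns'
    obtain ⟨y, hy, hdeg⟩ := hns'
    have hyX : y ∉ X := by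
      intro hyX
      have := hy y hyX
      rw [dist_self] at this
      exact absurd this (by norm_num)
    refine ⟨insert y X, ?_, ?_, ?_⟩
    · intro p hp q hq hpq
      rcases Finset.mem_insert.1 hp with rfl | hp'
      · rcases Finset.mem_insert.1 hq with rfl | hq'
        · exact absurd rfl hpq
        · exact hy q hq'
      · rcases Finset.mem_insert.1 hq with rfl | hq'
        · rw [dist_comm]; exact hy p hp'
        · exact hX p hp' q hq' hpq
    · rw [contactDeficiency_insert X hyX]
      have : (7 : ℝ) ≤ deg X y := by exact_mod_cast hdeg
      linarith
    · rw [Finset.insert_sdiff_of_notMem X hyX, Finset.sdiff_self, Finset.insert_empty,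
        Finset.card_singleton, Finset.sdiff_insert, Finset.sdiff_self, Finset.erase_empty,
        Finset.card_empty]
  · -- some point has `≤ 5` contacts: delete it
    push Not at h6
    obtain ⟨p, hp, hdeg⟩ := h6
    refine ⟨X.erase p, fun a ha b hb hab => hX a (Finset.mem_of_mem_erase ha) b
      (Finset.mem_of_mem_erase hb) hab, ?_, ?_⟩
    · rw [contactDeficiency_erase X hp]
      have : (deg X p : ℝ) ≤ 5 := by exact_mod_cast Nat.lt_succ_iff.1 hdeg
      linarith
    · rw [Finset.erase_sdiff_comm, Finset.sdiff_self, Finset.erase_empty, Finset.card_empty,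
        Finset.sdiff_erase_self hp, Finset.card_singleton]

/-- **Finset saturation lemma.** Every finite `1`-separated `X ⊂ ℝ³` admits a finite `1`-separated `X'` that is
6|6-SATURATED (every point of `X'` has `≥ 6` points of `X'` at distance `1`; every point at distance `≥ 1` from
all of `X'` has `≤ 6` points of `X'` at distance `1`) with `D(X') + #(X' ∖ X) + #(X ∖ X') ≤ D(X)`. -/
theorem exists_saturated_finset (X : Finset E3) (hX : ∀ p ∈ X, ∀ q ∈ X, p ≠ q → 1 ≤ dist p q) :
    ∃ X' : Finset E3, (∀ p ∈ X', ∀ q ∈ X', p ≠ q → 1 ≤ dist p q) ∧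
      (∀ p ∈ X', 6 ≤ (X'.filter fun q => dist p q = 1).card) ∧
      (∀ y : E3, (∀ p ∈ X', 1 ≤ dist y p) → (X'.filter fun p => dist y p = 1).card ≤ 6) ∧
      contactDeficiency X' + ((X' \ X).card : ℝ) + ((X \ X').card : ℝ) ≤ contactDeficiency X := by
  classical
  -- induction on a natural bound for `2 D(X)`
  suffices H : ∀ k : ℕ, ∀ X : Finset E3, (∀ p ∈ X, ∀ q ∈ X, p ≠ q → 1 ≤ dist p q) →
      2 * contactDeficiency X ≤ k →
      ∃ X' : Finset E3, (∀ p ∈ X', ∀ q ∈ X', p ≠ q → 1 ≤ dist p q) ∧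
        (∀ p ∈ X', 6 ≤ deg X' p) ∧ (∀ y : E3, (∀ p ∈ X', 1 ≤ dist y p) → deg X' y ≤ 6) ∧
        contactDeficiency X' + ((X' \ X).card : ℝ) + ((X \ X').card : ℝ) ≤ contactDeficiency X by
    obtain ⟨k, hk⟩ := exists_nat_ge (2 * contactDeficiency X)
    exact H k X hX hk
  intro k
  induction k with
  | zero =>
    intro X hX hk
    by_cases hs : (∀ p ∈ X, 6 ≤ deg X p) ∧ ∀ y : E3, (∀ p ∈ X, 1 ≤ dist y p) → deg X y ≤ 6
    · exact ⟨X, hX, hs.1, hs.2, by simp⟩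
    · obtain ⟨X₁, hX₁, hD, -⟩ := saturation_step X hX hs
      have h0 := contactDeficiency_nonneg' X₁ hX₁
      push_cast at hk
      linarith
  | succ k ih =>
    intro X hX hk
    by_cases hs : (∀ p ∈ X, 6 ≤ deg X p) ∧ ∀ y : E3, (∀ p ∈ X, 1 ≤ dist y p) → deg X y ≤ 6
    · exact ⟨X, hX, hs.1, hs.2, by simp⟩
    · obtain ⟨X₁, hX₁, hD, hcard⟩ := saturation_step X hX hs
      have hk₁ : 2 * contactDeficiency X₁ ≤ k := by push_cast at hk; linarith
      obtain ⟨X', hX', h6, hsat, hbook⟩ := ih X₁ hX₁ hk₁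
      refine ⟨X', hX', h6, hsat, ?_⟩
      -- bookkeeping of the symmetric difference through the one-point step
      have h1 : (X' \ X).card ≤ (X' \ X₁).card + (X₁ \ X).card := by
        calc (X' \ X).card ≤ ((X' \ X₁) ∪ (X₁ \ X)).card := by
              refine Finset.card_le_card fun q hq => ?_
              rw [Finset.mem_union, Finset.mem_sdiff, Finset.mem_sdiff]
              rw [Finset.mem_sdiff] at hq
              by_cases hq1 : q ∈ X₁
              · exact Or.inr ⟨hq1, hq.2⟩
              · exact Or.inl ⟨hq.1, hq1⟩
          _ ≤ (X' \ X₁).card + (X₁ \ X).card := Finset.card_union_le _ _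
      have h2 : (X \ X').card ≤ (X₁ \ X').card + (X \ X₁).card := by
        calc (X \ X').card ≤ ((X₁ \ X') ∪ (X \ X₁)).card := by
              refine Finset.card_le_card fun q hq => ?_
              rw [Finset.mem_union, Finset.mem_sdiff, Finset.mem_sdiff]
              rw [Finset.mem_sdiff] at hq
              by_cases hq1 : q ∈ X₁
              · exact Or.inl ⟨hq1, hq.2⟩
              · exact Or.inr ⟨hq.1, hq1⟩
          _ ≤ (X₁ \ X').card + (X \ X₁).card := Finset.card_union_le _ _
      have h1' : ((X' \ X).card : ℝ) ≤ (X' \ X₁).card + (X₁ \ X).card := by exact_mod_cast h1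
      have h2' : ((X \ X').card : ℝ) ≤ (X₁ \ X').card + (X \ X₁).card := by exact_mod_cast h2
      have hc' : ((X₁ \ X).card : ℝ) + (X \ X₁).card ≤ 1 := by exact_mod_cast hcard
      linarith

end FinsetSaturation

/-! ## §3 The labelled form (signature of cf-p1's `Saturation.lean`) -/

/-- filter-cardinalities of a labelled injective configuration are those of its point set -/
private theorem card_filter_univ_eq_card_filter_image {N : ℕ} (x : Fin N → E3) (hx : Function.Injective x)
    (P : E3 → Prop) [DecidablePred P] :
    (Finset.univ.filter fun i => P (x i)).card = ((Finset.univ.image x).filter P).card := by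
  classical
  rw [Finset.filter_image, Finset.card_image_of_injective _ hx]

/-- coordination number of a ball of a unit packing = number of points of the point set at distance `1` -/
private theorem coordination_eq_card_filter {N : ℕ} (x : Fin N → E3) (hx : Function.Injective x) (i : Fin N) :
    coordination x i = ((Finset.univ.image x).filter fun q => dist (x i) q = 1).card := by
  classical
  rw [coordination, contactNeighbors, ← card_filter_univ_eq_card_filter_image x hx]
  congr 1
  ext j
  simp only [Finset.mem_filter, Finset.mem_univ, true_and, and_iff_right_iff_imp]
  intro h hji
  rw [hji, dist_self] at h
  exact zero_ne_one h

/-- `touchCount` = number of points of the point set at distance `1` -/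
private theorem touchCount_eq_card_filter {N : ℕ} (x : Fin N → E3) (hx : Function.Injective x) (y : E3) :
    touchCount x y = ((Finset.univ.image x).filter fun q => dist y q = 1).card := by
  classical
  rw [touchCount, ← card_filter_univ_eq_card_filter_image x hx]

/-- **Saturation lemma** (cf-p1 `Saturation.lean`, `exists_saturated`, signature verbatim): every unit packing can be
made 6|6-saturated by `steps` one-ball deletions/additions with `|N' − N| ≤ steps` and
`(6N' − C') + steps ≤ 6N − C`. -/
theorem exists_saturated {N : ℕ} (x : Fin N → EuclideanSpace ℝ (Fin 3)) (hx : IsUnitPacking x) :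
    ∃ (N' : ℕ) (x' : Fin N' → EuclideanSpace ℝ (Fin 3)) (steps : ℕ),
      IsUnitPacking x' ∧ IsSaturated x' ∧
      (N : ℝ) ≤ N' + steps ∧ (N' : ℝ) ≤ N + steps ∧
      (6 * (N' : ℝ) - (numContacts x' : ℝ)) + steps ≤ 6 * (N : ℝ) - (numContacts x : ℝ) ∧
      (Set.range x' \ Set.range x ∪ (Set.range x \ Set.range x')).ncard ≤ steps := by
  classical
  set X : Finset E3 := Finset.univ.image x with hXdef
  have hxinj : Function.Injective x := hx.injective
  have hXsep : ∀ p ∈ X, ∀ q ∈ X, p ≠ q → 1 ≤ dist p q := by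
    intro p hp q hq hpq
    obtain ⟨i, -, rfl⟩ := Finset.mem_image.1 hp
    obtain ⟨j, -, rfl⟩ := Finset.mem_image.1 hq
    exact hx (fun h => hpq (by rw [h]))
  obtain ⟨X', hX'sep, h6, hsat, hbook⟩ := exists_saturated_finset X hXsep
  -- relabel `X'` by `Fin X'.card`
  set N' := X'.card with hN'def
  let e : Fin N' ≃ {p // p ∈ X'} := X'.equivFin.symm
  let x' : Fin N' → E3 := fun i => (e i : E3)
  have hx'inj : Function.Injective x' := fun i j h => e.injective (Subtype.ext h)
  have hx'mem : ∀ i, x' i ∈ X' := fun i => (e i).2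
  have himage : Finset.univ.image x' = X' := by
    ext p
    simp only [Finset.mem_image, Finset.mem_univ, true_and]
    constructor
    · rintro ⟨i, rfl⟩; exact hx'mem i
    · intro hp; exact ⟨e.symm ⟨p, hp⟩, by simp [x']⟩
  have hx'pack : IsUnitPacking x' := by
    intro i j hij
    exact hX'sep _ (hx'mem i) _ (hx'mem j) (fun h => hij (hx'inj h))
  refine ⟨N', x', (X' \ X).card + (X \ X').card, hx'pack, ⟨?_, ?_⟩, ?_, ?_, ?_, ?_⟩
  · intro i
    rw [coordination_eq_card_filter x' hx'inj, himage]
    exact h6 _ (hx'mem i)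
  · intro y hy
    rw [touchCount_eq_card_filter x' hx'inj, himage]
    exact hsat y fun p hp => by
      have := hy (e.symm ⟨p, hp⟩)
      simpa [x'] using this
  · have h := Finset.card_le_card_sdiff_add_card (s := X) (t := X')
    have hN : X.card = N := card_image_univ_eq x hxinj
    rw [hN] at h
    have hle : (X \ X').card + X'.card ≤ N' + ((X' \ X).card + (X \ X').card) := by omega
    exact_mod_cast h.trans hle
  · have h := Finset.card_le_card_sdiff_add_card (s := X') (t := X)
    have hN : X.card = N := card_image_univ_eq x hxinj
    rw [hN] at h
    push_cast
    have : (N' : ℝ) ≤ (X' \ X).card + N := by exact_mod_cast h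
    linarith
  · have hD : contactDeficiency X = 6 * (N : ℝ) - (numContacts x : ℝ) :=
      contactDeficiency_image_eq x hxinj
    have hD' : contactDeficiency X' = 6 * (N' : ℝ) - (numContacts x' : ℝ) := by
      rw [← himage]; exact contactDeficiency_image_eq x' hx'inj
    push_cast
    linarith
  · have hr : Set.range x = ↑X := by rw [hXdef, Finset.coe_image, Finset.coe_univ, Set.image_univ]
    have hr' : Set.range x' = ↑X' := by rw [← himage, Finset.coe_image, Finset.coe_univ, Set.image_univ]
    rw [hr, hr', ← Finset.coe_sdiff, ← Finset.coe_sdiff, ← Finset.coe_union, Set.ncard_coe_finset]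
    exact Finset.card_union_le _ _

end Summit.Ventures.Crystal3D.Cruxes.TextureLiminf.TexShadow
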